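import Summits.Ventures.HSemireg.LeadingDigitRemainder
import Summits.Ventures.HSemireg.DigitSpaceClause
import Summits.Ventures.HSemireg.TwoVectorDividedPowers
import Summits.Ventures.HSemireg.EdgeUnitClosedForms

/-!
# LEMMA C: the (2,2,2,3,3,3) frame is CLASS-DEAD — one theorem (pub-hsemireg, S4-PUSH corner 2)

Kernel leg of seat s4-search-2 gen 16 (cell `pub-hsemireg`); companion of `EdgeUnitClassDead.lean` (ROW J) and
`MixedFrameClassDead.lean` (ROW K) for the THIRD open frame of the M2 cell: the `E = ∅` dual type `(2,2,2,3,3,3)` with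
`v₂(σ₂) = 1` (63 classes), LEMMA C of `s4push/search-2/g11/LIFT2-search-2-g11.md` §5 («S2-21»; of record pencil ×1 +
machine ×2: «315 ∕ 315 inconsistent + the zero digit», standalone check «Ω̄₃∧ā ≠ 0 for all 4 095 non-zero ā ∈ 𝔽₂¹²»).
Memo: `D = 4P + 8Q`, `P = h₀ + h₁ + h₂`, `Q = h₃ + h₄ + h₅`; a leading digit is `β = 0` or a decomposable lift `a ∧ b`
(`β^[2] = 0`); `T₂(β + 2X + 4Y) ≡ 32σ₂′P^[2] + 32σ₀βX mod 64`, so the `k = 2` digit equation reads `β̄∧X̄ = Ω̄₃ :=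
h̄₀h̄₁ + h̄₀h̄₂ + h̄₁h̄₂`; `β = 0` is impossible (`Ω̄₃ ≠ 0`) and for `β̄ = ā∧b̄ ≠ 0`, `Ω̄₃∧ā = 0` would be forced, whereas
`Ω̄₃∧ā ≠ 0` for every `ā ≠ 0` (Lefschetz for `P̄` on `V₀₁₂`).

**THE STATEMENT (`lemmaC_classDead`).**  `M` free with basis `x : Fin 12`; slots `hᵢ`, `P, Q` as above with the
registered `P₂ = P^[2] = h₀h₁ + h₀h₂ + h₁h₂`, `Q₂ = Q^[2]`, the type `D = 4P + 8Q` with `D₂ = D^[2] = 16P₂ + 32PQ + 64Q₂`;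
a signature `σ₁ = 0`, `σ₀ = 2s + 1`, `σ₂ = 4t + 2` (`s, t` any even elements); the leading digit `β = ι a · ι b` for ANY
two vectors `a, b ∈ M` (every decomposable integral 2-form, `β̄ = 0` included); ANY `X` in the span of the 2-vectors (every
integral 2-form); the class 2-form `B = ι a ι b + 2X` and ANY `B₂` with `B·B = 2B₂`; the registered
`T₂(B) = σ₂D₂ − 4σ₁DB + 16σ₀B₂`.  THEN `∀ Z ∈ Λ, T₂(B) ≠ 64·Z`: CRITERION L fails at `k = 2` for every completion of
every leading digit of rank `≤ 2` — the 63 classes are CLASS-DEAD, as ONE kernel theorem.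

**Proof.**  `B₂ = 2βX + 4X₂` (`β·β = 0`, `TwoVectorDividedPowers`, `EdgeUnitClosedForms.sq_shift_two`, `cancel_two`);
`T₂ = 32·(P₂ + βX) + 64·W₁` (`noncomm_ring`); `T₂ = 64Z` ⇒ `P₂ + βX = 2W′` (cancel `32`); multiply by `ι a` on the left:
`ι a · P₂ = 2·ι a·W′` (`ι a · ι a = 0`); four integer-valued coefficient functionals of degree 5 (`τ ∘ Λ(π)`, `π` the
projection to the coordinate `j ∈ {0,1,2,3}` and the two slots of `{0,1,2}` other than `j`'s, via a reindexed basis — the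
machinery of `TwoAdicReadings` §1 ∕ `DigitSpaceClause`) read off `2 ∣ x.repr a j` for `j = 0, …, 3` (the slot-pair part
of the memo's «`Ω̄₃∧ā ≠ 0`»); so under the degree-4 functional `Φ` of the slot pair `0, 1` the image of `ι a` is twice a
vector, `Φ(βX)` and `Φ(2W′)` are even while `Φ(P₂) = 1` — contradiction.  (The memo's full statement «`ā = 0`» is not
needed: the four slot-pair coordinates suffice.)

Scope ∕ honest framing as in ROW J: a CLASS-LEVEL statement for ONE unit of a NECESSARY-condition sieve (CRITERION L) at
the special fibre `E⁶`; that the leading digits of these `E = ∅` units are the 2-forms of rank `≤ 2` (divided square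
zero), that CRITERION L is the registered necessary condition, the signature table and the census (63 classes) are
framework words; theorems only (count-neutral, no `def`); no object, no `σ` computation, no Hodge statement; nothing
here bears on HC ∕ HC_CM ∕ HC_AV.
-/

namespace Summit.Ventures.HSemireg.LemmaCFrameClassDead

open ExteriorAlgebra TwoSlotFrameTable TwoAdicReadings LeadingDigitRemainder DigitSpaceClause DividedSquareLemma
  TwoVectorDividedPowers EdgeUnitClosedForms
open scoped IsMulCommutative

section LocalTools

/-! ### 0. Local tools (a `private` copy of the landed `MixedFrameClassDead.cancel_two`, so that this file imports only the rows it uses) -/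

variable {M : Type*} [AddCommGroup M] [Module ℤ M]

/-- Cancelling `2` (torsion-freeness, `LeadingDigitRemainder.natCast_mul_cancel`); `private` local helper (the same
statement is landed as `MixedFrameClassDead.cancel_two`). -/
private theorem cancel_two (x : Module.Basis (Fin 12) ℤ M) {Q Q' : ExteriorAlgebra ℤ M}
    (h : (2 : ExteriorAlgebra ℤ M) * Q = 2 * Q') : Q = Q' :=
  LeadingDigitRemainder.natCast_mul_cancel x 2 (by norm_num) Q Q' (by exact_mod_cast h)

end LocalTools

section Functionals

/-! ### 1. Degree-5 coefficient functionals -/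

/-- The five-fold product `ι e₀ · ((ι e₁ · ι e₂) · (ι e₃ · ι e₄))` in `Λ(R⁵)` is `ιMulti R 5 e`. -/
theorem prod_five_eq_ιMulti (R : Type*) [CommRing R] :
    ι R (Pi.single 0 1 : Fin 5 → R) * (ι R (Pi.single 1 1 : Fin 5 → R) * ι R (Pi.single 2 1 : Fin 5 → R)
      * (ι R (Pi.single 3 1 : Fin 5 → R) * ι R (Pi.single 4 1 : Fin 5 → R)))
      = ιMulti R 5 (fun i => (Pi.single i 1 : Fin 5 → R)) := by
  rw [ιMulti_apply]
  simp [List.ofFn_succ, mul_assoc]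

variable {R : Type*} [CommRing R] {N : Type*} [AddCommGroup N] [Module R N]

/-- `ι u · ((ι u · ι v) · Y) = 0`. -/
theorem kill₁ (u v : N) (Y : ExteriorAlgebra R N) : ι R u * (ι R u * ι R v * Y) = 0 := by
  rw [← mul_assoc, ← mul_assoc, ι_sq_zero, zero_mul, zero_mul]

/-- `ι v · ((ι u · ι v) · Y) = 0`. -/
theorem kill₂ (u v : N) (Y : ExteriorAlgebra R N) : ι R v * (ι R u * ι R v * Y) = 0 := by
  rw [← mul_assoc, ← mul_assoc, ι_mul_ι_eq_neg v u, neg_mul, neg_mul, mul_assoc (ι R u), ι_sq_zero, mul_zero,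
    zero_mul, neg_zero]

/-- `ι u · ((ι p · ι q) · (ι u · ι v)) = 0` (the 2-vector `ι p ι q` is central). -/
theorem kill₃ (p q u v : N) : ι R u * (ι R p * ι R q * (ι R u * ι R v)) = 0 := by
  rw [← mul_assoc, ← ι_mul_ι_mul_comm p q (ι R u), mul_assoc, ← mul_assoc (ι R u) (ι R u), ι_sq_zero, zero_mul,
    mul_zero]

/-- `ι v · ((ι p · ι q) · (ι u · ι v)) = 0`. -/
theorem kill₄ (p q u v : N) : ι R v * (ι R p * ι R q * (ι R u * ι R v)) = 0 := by
  rw [ι_mul_ι_eq_neg u v, mul_neg, mul_neg, kill₃, neg_zero]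

/-- A `ℤ`-linear functional commutes with doubling: `φ (2·Y) = 2·φ Y` (additivity only; the numeral stays a literal). -/
theorem apply_two_mul {A : Type*} [Ring A] [Module ℤ A] (φ : A →ₗ[ℤ] ℤ) (Y : A) : φ (2 * Y) = 2 * φ Y := by
  rw [two_mul, map_add, two_mul]

variable {M : Type*} [AddCommGroup M] [Module ℤ M]

/-- The projection `M → ℤ⁵` to the coordinates `0, …, 4` of a basis `b`: `b 0, …, b 4 ↦ e₀, …, e₄`, `b 5, … ↦ 0`. -/
theorem projFive_basis (b : Module.Basis (Fin 12) ℤ M) (i : Fin 12) :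
    (LinearMap.funLeft ℤ ℤ (Fin.castLE (show 5 ≤ 12 by decide)) ∘ₗ (b.equivFun : M →ₗ[ℤ] (Fin 12 → ℤ))) (b i)
      = (![Pi.single 0 1, Pi.single 1 1, Pi.single 2 1, Pi.single 3 1, Pi.single 4 1, 0, 0, 0, 0, 0, 0, 0]
          : Fin 12 → (Fin 5 → ℤ)) i := by
  funext j
  simp only [LinearMap.coe_comp, Function.comp_apply, LinearMap.funLeft_apply, LinearEquiv.coe_coe,
    Module.Basis.equivFun_self, Fin.ext_iff, Fin.val_castLE]
  fin_cases i <;> fin_cases j <;> simp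

/-- The same for the REINDEXED basis `x.reindex e`, evaluated on the original basis vectors. -/
theorem projFive_reindex (x : Module.Basis (Fin 12) ℤ M) (e : Fin 12 ≃ Fin 12) (k : Fin 12) :
    (LinearMap.funLeft ℤ ℤ (Fin.castLE (show 5 ≤ 12 by decide))
      ∘ₗ ((x.reindex e).equivFun : M →ₗ[ℤ] (Fin 12 → ℤ))) (x k)
      = (![Pi.single 0 1, Pi.single 1 1, Pi.single 2 1, Pi.single 3 1, Pi.single 4 1, 0, 0, 0, 0, 0, 0, 0]
          : Fin 12 → (Fin 5 → ℤ)) (e k) := by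
  rw [show x k = (x.reindex e) (e k) by rw [Module.Basis.reindex_apply, Equiv.symm_apply_apply]]
  exact projFive_basis (x.reindex e) (e k)

/-- The projection of an ARBITRARY vector `a`: its five retained coordinates, `Σ_m x.repr a (e⁻¹ m) • e_m`. -/
theorem projFive_apply (x : Module.Basis (Fin 12) ℤ M) (e : Fin 12 ≃ Fin 12) (a : M) :
    (LinearMap.funLeft ℤ ℤ (Fin.castLE (show 5 ≤ 12 by decide))
      ∘ₗ ((x.reindex e).equivFun : M →ₗ[ℤ] (Fin 12 → ℤ))) a
      = ∑ m : Fin 5, x.repr a (e.symm (Fin.castLE (show 5 ≤ 12 by decide) m)) • (Pi.single m 1 : Fin 5 → ℤ) := by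
  funext j
  simp only [LinearMap.coe_comp, Function.comp_apply, LinearMap.funLeft_apply, LinearEquiv.coe_coe,
    Module.Basis.equivFun_apply, Module.Basis.repr_reindex_apply, Finset.sum_apply, Pi.smul_apply, Pi.single_apply,
    smul_eq_mul, mul_ite, mul_one, mul_zero, Finset.sum_ite_eq, Finset.mem_univ, if_true]

end Functionals

section LemmaC

/-! ### 2. LEMMA C: the (2,2,2,3,3,3) frame -/

variable {M : Type*} [AddCommGroup M] [Module ℤ M]

set_option maxHeartbeats 800000 in
/-- **LEMMA C — THE (2,2,2,3,3,3) FRAME IS CLASS-DEAD.**  See the module docstring: for ANY vectors `a, b ∈ M`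
(leading digit `β = ι a ι b`, every 2-form of rank `≤ 2`), ANY `X` in the span of the 2-vectors, `B = ι a ι b + 2X`
with ANY `B₂` such that `B·B = 2B₂`, the type `D = 4P + 8Q` with the registered `P₂, Q₂, D₂`, and `σ₁ = 0`,
`σ₀ = 2s + 1`, `σ₂ = 4t + 2`: the registered `T₂(B)` is not in `64Λ`.  (The hypotheses `_hh₃ … _hD` only record
the type's data; the proof does not use them — `D` enters `T₂` through `σ₁ = 0` and `P·Q`, `Q₂` through `64·D₂`-multiples —
so the statement holds for arbitrary `P, Q, Q₂, D`; `ms`, `mt` are likewise only bookkeeping of the setting.) -/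
theorem lemmaC_classDead (x : Module.Basis (Fin 12) ℤ M) (Λ : Subalgebra ℤ (ExteriorAlgebra ℤ M))
    (h₀ h₁ h₂ h₃ h₄ h₅ σ₀ σ₁ σ₂ s t P Q P₂ Q₂ D D₂ X B B₂ T₂ : ExteriorAlgebra ℤ M) (a b : M)
    (hΛ : Λ = Algebra.adjoin ℤ (Set.range fun p : M × M => ι ℤ p.1 * ι ℤ p.2))
    (hh₀ : h₀ = ι ℤ (x 0) * ι ℤ (x 1)) (hh₁ : h₁ = ι ℤ (x 2) * ι ℤ (x 3)) (hh₂ : h₂ = ι ℤ (x 4) * ι ℤ (x 5))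
    (_hh₃ : h₃ = ι ℤ (x 6) * ι ℤ (x 7)) (_hh₄ : h₄ = ι ℤ (x 8) * ι ℤ (x 9)) (_hh₅ : h₅ = ι ℤ (x 10) * ι ℤ (x 11))
    (ms : s ∈ Λ) (mt : t ∈ Λ)
    (_hP : P = h₀ + h₁ + h₂) (_hQ : Q = h₃ + h₄ + h₅) (hP₂ : P₂ = h₀ * h₁ + h₀ * h₂ + h₁ * h₂)
    (_hQ₂ : Q₂ = h₃ * h₄ + h₃ * h₅ + h₄ * h₅) (_hD : D = 4 * P + 8 * Q) (hD₂ : D₂ = 16 * P₂ + 32 * (P * Q) + 64 * Q₂)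
    (mX : X ∈ Submodule.span ℤ (Set.range fun p : M × M => ι ℤ p.1 * ι ℤ p.2))
    (hB : B = ι ℤ a * ι ℤ b + 2 * X) (qB : B * B = 2 * B₂)
    (hσ₁ : σ₁ = 0) (hσ₂ : σ₂ = 4 * t + 2) (hσ₀ : σ₀ = 2 * s + 1)
    (hT₂ : T₂ = σ₂ * D₂ - 4 * σ₁ * (D * B) + 16 * σ₀ * B₂) :
    ∀ Z ∈ Λ, T₂ ≠ 64 * Z := by
  intro Z mZ hcrit
  -- the divided square of `B = β + 2X`: `B₂ = 2βX + 4X₂`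
  obtain ⟨X₂, mX₂', X₃, -, qX, -⟩ := exists_dividedPowers_of_mem_span X mX
  have span_le : Submodule.span ℤ (Set.range fun p : M × M => ι ℤ p.1 * ι ℤ p.2) ≤ Subalgebra.toSubmodule Λ := by
    rw [hΛ]; exact Algebra.span_le_adjoin ℤ _
  have mXΛ : X ∈ Λ := span_le mX
  have mX₂ : X₂ ∈ Λ := hΛ ▸ mX₂'
  have mβ : ι ℤ a * ι ℤ b ∈ Λ := hΛ ▸ Algebra.subset_adjoin ⟨(a, b), rfl⟩
  have k₂ : B * B = 2 * (0 + 2 * (ι ℤ a * ι ℤ b * X) + 4 * X₂) := by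
    subst hΛ
    haveI := TwoSlotGlue.isMulCommutative_twoVectorSubalgebra (R := ℤ) (M := M)
    set Λ := Algebra.adjoin ℤ (Set.range fun p : M × M => ι ℤ p.1 * ι ℤ p.2)
    have qβ : (⟨ι ℤ a * ι ℤ b, mβ⟩ : Λ) * ⟨ι ℤ a * ι ℤ b, mβ⟩ = 2 * 0 := by
      rw [mul_zero]; exact Subtype.ext (ι₄_eq_zero_13 a b b)
    have qXΛ : (⟨X, mXΛ⟩ : Λ) * ⟨X, mXΛ⟩ = 2 * ⟨X₂, mX₂⟩ := Subtype.ext (by push_cast; exact qX)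
    have mB : B ∈ Λ := by rw [hB]; exact Λ.add_mem mβ (Λ.mul_mem (Λ.natCast_mem 2) mXΛ)
    have hBΛ : (⟨B, mB⟩ : Λ) = ⟨ι ℤ a * ι ℤ b, mβ⟩ + 2 * ⟨X, mXΛ⟩ := Subtype.ext (by push_cast; exact hB)
    have k := congrArg Subtype.val (sq_shift_two (R := Λ) _ _ _ _ _ hBΛ qβ qXΛ)
    push_cast at k
    exact k
  have hB₂c := cancel_two x (qB.symm.trans k₂)
  -- `T₂ = 32·(P₂ + βX) + 64·W₁`
  have key : T₂ = 32 * (P₂ + ι ℤ a * ι ℤ b * X) + 64 * (t * P₂ + (2 * t + 1) * (P * Q) + (4 * t + 2) * Q₂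
      + s * (ι ℤ a * ι ℤ b * X) + (2 * s + 1) * X₂) := by
    rw [hT₂, hσ₁, hσ₂, hσ₀, hD₂, hB₂c]; noncomm_ring
  -- cancel `32`: the digit equation `P₂ + βX = 2W′`
  have key' : (64 : ExteriorAlgebra ℤ M) * Z = 32 * (P₂ + ι ℤ a * ι ℤ b * X) + 64 * (t * P₂ + (2 * t + 1) * (P * Q) + (4 * t + 2) * Q₂
      + s * (ι ℤ a * ι ℤ b * X) + (2 * s + 1) * X₂) := hcrit.symm.trans key
  have h32 : (32 : ExteriorAlgebra ℤ M) * (P₂ + ι ℤ a * ι ℤ b * X) = 32 * (2 * (Z - (t * P₂ + (2 * t + 1) * (P * Q)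
      + (4 * t + 2) * Q₂ + s * (ι ℤ a * ι ℤ b * X) + (2 * s + 1) * X₂))) := by
    rw [eq_sub_of_add_eq key'.symm]
    simp only [mul_sub, ← mul_assoc]
    norm_num
  have hdig := natCast_mul_cancel x 32 (by norm_num) _ _ (by exact_mod_cast h32)
  generalize hW : Z - (t * P₂ + (2 * t + 1) * (P * Q) + (4 * t + 2) * Q₂ + s * (ι ℤ a * ι ℤ b * X)
    + (2 * s + 1) * X₂) = W at hdig
  -- multiply by `ι a` on the left: `ι a · P₂ = 2·(ι a · W′)`
  have h5 : ι ℤ a * P₂ = 2 * (ι ℤ a * W) := by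
    have h := congrArg (fun z => ι ℤ a * z) hdig
    rw [mul_add, kill₁, add_zero, (Commute.ofNat_right (ι ℤ a) 2).left_comm] at h
    exact h
  generalize hW₅ : ι ℤ a * W = W₅ at h5
  -- coordinate readings: the coordinates of `a` on the slots `0, 1` are even
  obtain ⟨τ, hτ⟩ := exists_topCoeff ℤ 5
  have c0 : Fin.castLE (show 5 ≤ 12 by decide) (0 : Fin 5) = (0 : Fin 12) := rfl
  have c1 : Fin.castLE (show 5 ≤ 12 by decide) (1 : Fin 5) = (1 : Fin 12) := rfl
  have c2 : Fin.castLE (show 5 ≤ 12 by decide) (2 : Fin 5) = (2 : Fin 12) := rfl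
  have c3 : Fin.castLE (show 5 ≤ 12 by decide) (3 : Fin 5) = (3 : Fin 12) := rfl
  have c4 : Fin.castLE (show 5 ≤ 12 by decide) (4 : Fin 5) = (4 : Fin 12) := rfl
  have read : ∀ e : Fin 12 ≃ Fin 12,
      τ (ExteriorAlgebra.map (LinearMap.funLeft ℤ ℤ (Fin.castLE (show 5 ≤ 12 by decide))
          ∘ₗ ((x.reindex e).equivFun : M →ₗ[ℤ] (Fin 12 → ℤ))) (ι ℤ a)
        * ExteriorAlgebra.map (LinearMap.funLeft ℤ ℤ (Fin.castLE (show 5 ≤ 12 by decide))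
          ∘ₗ ((x.reindex e).equivFun : M →ₗ[ℤ] (Fin 12 → ℤ))) P₂)
        = 2 * τ (ExteriorAlgebra.map (LinearMap.funLeft ℤ ℤ (Fin.castLE (show 5 ≤ 12 by decide))
          ∘ₗ ((x.reindex e).equivFun : M →ₗ[ℤ] (Fin 12 → ℤ))) W₅) := by
    intro e
    have h := congrArg (fun z => τ (ExteriorAlgebra.map (LinearMap.funLeft ℤ ℤ (Fin.castLE (show 5 ≤ 12 by decide))
      ∘ₗ ((x.reindex e).equivFun : M →ₗ[ℤ] (Fin 12 → ℤ))) z)) h5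
    simp only [map_mul, map_ofNat] at h
    rw [apply_two_mul] at h
    exact h
  have d0 : 2 ∣ x.repr a 0 := by
    have h := read ⟨![0, 5, 1, 2, 3, 4, 6, 7, 8, 9, 10, 11], ![0, 2, 3, 4, 5, 1, 6, 7, 8, 9, 10, 11], by decide, by decide⟩
    rw [map_apply_ι, projFive_apply, Fin.sum_univ_five] at h
    simp only [Equiv.coe_fn_symm_mk, Matrix.cons_val, c0, c1, c2, c3, c4, hP₂, hh₀, hh₁, hh₂, map_add, map_zsmul,
      map_mul, map_apply_ι, projFive_reindex, Equiv.coe_fn_mk, map_zero, mul_zero, zero_mul, smul_zero,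
      add_zero, zero_add, add_mul, smul_mul_assoc, kill₁, kill₂, kill₃, kill₄, prod_five_eq_ιMulti,
      smul_eq_mul, hτ, mul_one] at h
    omega
  have d1 : 2 ∣ x.repr a 1 := by
    have h := read ⟨![5, 0, 1, 2, 3, 4, 6, 7, 8, 9, 10, 11], ![1, 2, 3, 4, 5, 0, 6, 7, 8, 9, 10, 11], by decide, by decide⟩
    rw [map_apply_ι, projFive_apply, Fin.sum_univ_five] at h
    simp only [Equiv.coe_fn_symm_mk, Matrix.cons_val, c0, c1, c2, c3, c4, hP₂, hh₀, hh₁, hh₂, map_add, map_zsmul,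
      map_mul, map_apply_ι, projFive_reindex, Equiv.coe_fn_mk, map_zero, zero_mul, smul_zero, add_zero,
      zero_add, add_mul, smul_mul_assoc, kill₁, kill₂, kill₃, kill₄, prod_five_eq_ιMulti, smul_eq_mul,
      hτ, mul_one] at h
    omega
  have d2 : 2 ∣ x.repr a 2 := by
    have h := read ⟨![1, 2, 0, 5, 3, 4, 6, 7, 8, 9, 10, 11], ![2, 0, 1, 4, 5, 3, 6, 7, 8, 9, 10, 11], by decide, by decide⟩
    rw [map_apply_ι, projFive_apply, Fin.sum_univ_five] at h
    simp only [Equiv.coe_fn_symm_mk, Matrix.cons_val, c0, c1, c2, c3, c4, hP₂, hh₀, hh₁, hh₂, map_add, map_zsmul,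
      map_mul, map_apply_ι, projFive_reindex, Equiv.coe_fn_mk, map_zero, mul_zero, zero_mul, smul_zero,
      add_zero, zero_add, add_mul, smul_mul_assoc, kill₁, kill₂, kill₃, kill₄, prod_five_eq_ιMulti,
      smul_eq_mul, hτ, mul_one] at h
    omega
  have d3 : 2 ∣ x.repr a 3 := by
    have h := read ⟨![1, 2, 5, 0, 3, 4, 6, 7, 8, 9, 10, 11], ![3, 0, 1, 4, 5, 2, 6, 7, 8, 9, 10, 11], by decide, by decide⟩
    rw [map_apply_ι, projFive_apply, Fin.sum_univ_five] at h
    simp only [Equiv.coe_fn_symm_mk, Matrix.cons_val, c0, c1, c2, c3, c4, hP₂, hh₀, hh₁, hh₂, map_add, map_zsmul,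
      map_mul, map_apply_ι, projFive_reindex, Equiv.coe_fn_mk, map_zero, mul_zero, zero_mul, smul_zero,
      add_zero, zero_add, add_mul, smul_mul_assoc, kill₁, kill₂, kill₃, kill₄, prod_five_eq_ιMulti,
      smul_eq_mul, hτ, mul_one] at h
    omega
  -- `a = 2a′`, `β = 2·ι a′ ι b`, so `P₂ = 2·(W′ − ι a′ ι b X)`
  -- the four coordinates of `a` on the slots `0, 1` are even: the degree-4 functional of that slot pair reads
  -- `Φ(P₂) = 1`, `Φ(βX)` even, `Φ(2W)` even — contradiction
  obtain ⟨τ₄, hτ₄⟩ := exists_topCoeff ℤ 4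
  have hv : (LinearMap.funLeft ℤ ℤ (Fin.castLE (show 4 ≤ 12 by decide)) ∘ₗ (x.equivFun : M →ₗ[ℤ] (Fin 12 → ℤ))) a
      = (fun m => x.repr a (Fin.castLE (show 4 ≤ 12 by decide) m) / 2)
        + (fun m => x.repr a (Fin.castLE (show 4 ≤ 12 by decide) m) / 2) := by
    funext m
    simp only [LinearMap.coe_comp, Function.comp_apply, LinearMap.funLeft_apply, LinearEquiv.coe_coe,
      Module.Basis.equivFun_apply, Pi.add_apply]
    fin_cases m
    · change x.repr a 0 = x.repr a 0 / 2 + x.repr a 0 / 2; omega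
    · change x.repr a 1 = x.repr a 1 / 2 + x.repr a 1 / 2; omega
    · change x.repr a 2 = x.repr a 2 / 2 + x.repr a 2 / 2; omega
    · change x.repr a 3 = x.repr a 3 / 2 + x.repr a 3 / 2; omega
  have h := congrArg (fun z => τ₄ (ExteriorAlgebra.map
    (LinearMap.funLeft ℤ ℤ (Fin.castLE (show 4 ≤ 12 by decide)) ∘ₗ (x.equivFun : M →ₗ[ℤ] (Fin 12 → ℤ))) z)) hdig
  simp only [map_add, map_mul, map_ofNat] at h
  rw [apply_two_mul, map_apply_ι _ a, hv, map_add, ← two_mul, mul_assoc, mul_assoc, apply_two_mul,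
    hP₂, hh₀, hh₁, hh₂] at h
  simp only [map_add, map_mul, map_apply_ι, projFour_basis, Matrix.cons_val, map_zero, mul_zero, add_zero,
    prod_four_eq_ιMulti, hτ₄] at h
  omega

end LemmaC

end Summit.Ventures.HSemireg.LemmaCFrameClassDead
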